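import Literature.AlgebraicGeometry.Resolution.ProOpenIdealExtension
import Literature.AlgebraicGeometry.Resolution.BlowupsFlatBaseChange
import Literature.AlgebraicGeometry.Resolution.BlowupsExistence
import Literature.AlgebraicGeometry.Resolution.BlowupsProperProofs
import Literature.AlgebraicGeometry.Resolution.BlowupsIntegral
import Literature.AlgebraicGeometry.Resolution.ResolutionGlue
import Literature.AlgebraicGeometry.Resolution.QuasiExcellentSchemes
import HarnessLib

/-!
# Crux `NoZenoR` (stmt-ResolutionOfSingularities-19943) — toward the W3 print `Lipman1969_4_1`:
# GLOBALISATION — a scheme whose finitely many bad points have local rings desingularized by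
# blowing ups of `𝔪`-primary ideals is desingularized by ONE blowing up

Route `ResolutionOfSingularities/HomologicalConductor` (cell decomp-res, hand leafhand-res-homologicalconduct-16 g4).
OURS: AI-written, weaker than expert review; SUPPORT level, counted 0; def-free, fact-free (no named fact is used).
Nothing here is a statement of the manuscript under review (Hironaka 2017); no crux / summit statement is proved.

THE MATHEMATICS (folklore, print-free).  Let `Y` be an integral Noetherian scheme, `Σ ⊆ Y` a finite set of closed points
containing the singular locus and not the generic point, and suppose that for every `y ∈ Σ` the local scheme `Spec 𝒪_{Y,y}`
has a desingularization which is a blowing up along an ideal sheaf cosupported at the closed point (for normal surface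
singularities admitting a desingularization — e.g. rational ones — this is the companion file
`HomologicalConductorNoZenoRResolutionIsBlowup`).  Then `Y` has a desingularization which is a blowing up along an ideal
sheaf `J` with `V(J) ⊆ Σ` (in particular an isomorphism over `Y ∖ Σ`):
1. (Temkin 2008, Lemma 2.1.1, tree `exists_idealSheaf_extension_fromSpecStalk`, transported along
   `Y ×_Y Spec 𝒪_{Y,y} ≅ Spec 𝒪_{Y,y}`) every ideal sheaf `I` on `Spec 𝒪_{Y,y}` is `ι_y⁻¹ J_y · 𝒪` for an ideal sheaf `J_y`
   on `Y` with `V(J_y) = cl(ι_y(V(I)))`, `ι_y : Spec 𝒪_{Y,y} → Y`; if `V(I) ⊆ {𝔪_y}` and `y` is closed, `V(J_y) ⊆ {y}`;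
2. `J := ∏_{y ∈ Σ} J_y` has `V(J) ⊆ Σ` and `ι_y⁻¹ J · 𝒪 = ι_y⁻¹ J_y · 𝒪` (the other factors pull back to the unit ideal:
   a closed point `a ≠ y` is not a generization of `y`);
3. the blowing up `f : X = Bl_J(Y) → Y` (`exists_isBlowup`) is proper (`IsBlowup.isProper`), birational with `X` integral
   (`J ≠ 0` as the generic point is off `Σ`), an isomorphism off `V(J)`, so `X` is regular over `Y ∖ Σ`; over `y ∈ Σ`,
   blowing up commutes with the flat base change `ι_y` (`IsBlowup.pullback_snd_of_flat`), so `X ×_Y Spec 𝒪_{Y,y}` is a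
   blowing up of `Spec 𝒪_{Y,y}` along `ι_y⁻¹ J_y 𝒪 = I_y`, hence isomorphic to the given desingularization (`IsBlowup.unique`)
   and regular, and the local rings of `X` at points over `y` are local rings of `X ×_Y Spec 𝒪_{Y,y}`
   (`mem_regularLocus_iff_pullback_fst_fromSpecStalk`).

* `exists_comap_fromSpecStalk_eq` — step 1;
* `comap_fromSpecStalk_eq_top_of_support_subset` — an ideal sheaf cosupported at a closed point `a ≠ y` pulls back to the
  unit ideal on `Spec 𝒪_{Y,y}`;
* `prod_support_subset_and_comap` — step 2 (finite products);
* `exists_isResolution_isBlowup_of_local` — MAIN (step 3).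

Use: with `…ResolutionIsBlowup.exists_isResolution_isBlowup_support_subset_closedPoint` this gives the EXISTENCE half of
Lipman (4.1) (a normal surface with finitely many singular points whose local rings admit desingularizations — e.g. rational
singularities — has a desingularization), print-free; the minimality half of the print `Lipman1969_4_1` is not addressed here.
-/

noncomputable section

-- single-problem summit: the doubled namespace component `ResolutionOfSingularities` is forced
set_option linter.dupNamespace false

open CategoryTheory CategoryTheory.Limits AlgebraicGeometry TopologicalSpace IsLocalRing
open Literature.AlgebraicGeometry.Resolution

universe u

namespace Summit.ResolutionOfSingularities.ResolutionOfSingularities.Theorems.NoZeno.GlobalResolution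

variable {Y : Scheme.{u}}

/-! ## Step 1: extending an ideal sheaf from `Spec 𝒪_{Y,y}` -/

/-- **Every ideal sheaf on `Spec 𝒪_{Y,y}` is extended from `Y`** (Temkin 2008, Lemma 2.1.1 for the pro-open subscheme
`Spec 𝒪_{Y,y}`, tree `exists_idealSheaf_extension_fromSpecStalk` at `π = 𝟙`, transported along
`Y ×_Y Spec 𝒪_{Y,y} ≅ Spec 𝒪_{Y,y}`), with cosupport the closure of the image of `V(I)`; for `I` cosupported at the closed
point and `y` closed the extension is cosupported in `{y}`. [cite: Temkin2008, Lemma 2.1.1] -/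
theorem exists_comap_fromSpecStalk_eq [IsLocallyNoetherian Y] (y : Y) (hy : IsClosed ({y} : Set Y))
    (I : (Spec (Y.presheaf.stalk y)).IdealSheafData)
    (hI : (I.support : Set (Spec (Y.presheaf.stalk y))) ⊆ {closedPoint (Y.presheaf.stalk y)}) :
    ∃ J : Y.IdealSheafData, J.comap (Y.fromSpecStalk y) = I ∧ (J.support : Set Y) ⊆ {y} := by
  let ι := Y.fromSpecStalk y
  let e := pullback.snd (𝟙 Y) ι
  have hfst : pullback.fst (𝟙 Y) ι = e ≫ ι := by
    rw [← Category.comp_id (pullback.fst (𝟙 Y) ι)]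
    exact pullback.condition
  obtain ⟨J, hJ, hsupp⟩ := exists_idealSheaf_extension_fromSpecStalk (𝟙 Y) y (I.comap e)
  refine ⟨J, ?_, ?_⟩
  · have h1 : (J.comap ι).comap e = I.comap e := by
      rw [← Scheme.IdealSheafData.comap_comp, ← hfst]
      exact hJ
    have h2 := congrArg (fun K => K.comap (inv e)) h1
    simp only [← Scheme.IdealSheafData.comap_comp, IsIso.inv_hom_id_assoc, IsIso.inv_hom_id,
      Scheme.IdealSheafData.comap_id] at h2
    exact h2
  · rw [hsupp]
    refine closure_minimal ?_ hy
    rintro _ ⟨s, hs, rfl⟩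
    rw [Scheme.IdealSheafData.support_comap] at hs
    have hes : e s = closedPoint (Y.presheaf.stalk y) := hI hs
    show (pullback.fst (𝟙 Y) ι) s ∈ ({y} : Set Y)
    rw [hfst, Scheme.Hom.comp_apply, hes]
    exact Scheme.fromSpecStalk_closedPoint

/-- An ideal sheaf cosupported at a closed point `a ≠ y` pulls back to the unit ideal sheaf on `Spec 𝒪_{Y,y}`: the
points of `Spec 𝒪_{Y,y}` map to generizations of `y`, and the closed point `a` is not one. [folklore] -/
theorem comap_fromSpecStalk_eq_top_of_support_subset {a y : Y} (ha : IsClosed ({a} : Set Y)) (hne : a ≠ y)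
    (K : Y.IdealSheafData) (hK : (K.support : Set Y) ⊆ {a}) : K.comap (Y.fromSpecStalk y) = ⊤ := by
  rw [← Scheme.IdealSheafData.support_eq_bot_iff, eq_bot_iff]
  intro s hs
  rw [Scheme.IdealSheafData.support_comap] at hs
  have has : Y.fromSpecStalk y s = a := hK hs
  have hspec : Y.fromSpecStalk y s ⤳ y := Scheme.range_fromSpecStalk.le ⟨s, rfl⟩
  rw [has, specializes_iff_mem_closure, ha.closure_eq] at hspec
  exact absurd hspec.symm hne

/-! ## Step 2: finite products -/

/-- **Finite products of extensions**: for closed points `y ∈ T` and ideal sheaves `J_y` with `V(J_y) ⊆ {y}`, the product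
`∏_{y ∈ T} J_y` has `V ⊆ T`, pulls back to `ι_y⁻¹ J_y 𝒪` on `Spec 𝒪_{Y,y}` for `y ∈ T`, and to the unit ideal for a closed
point `y ∉ T`. [folklore] -/
theorem prod_support_subset_and_comap (Jf : Y → Y.IdealSheafData) (T : Finset Y)
    (hT : ∀ y ∈ T, IsClosed ({y} : Set Y)) (hJ : ∀ y ∈ T, ((Jf y).support : Set Y) ⊆ {y}) :
    ((∏ y ∈ T, Jf y).support : Set Y) ⊆ ↑T ∧
      (∀ y ∈ T, (∏ y' ∈ T, Jf y').comap (Y.fromSpecStalk y) = (Jf y).comap (Y.fromSpecStalk y)) ∧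
      (∀ y, IsClosed ({y} : Set Y) → y ∉ T → (∏ y' ∈ T, Jf y').comap (Y.fromSpecStalk y) = ⊤) := by
  classical
  induction T using Finset.induction_on with
  | empty =>
    refine ⟨?_, fun y hy => absurd hy (Finset.notMem_empty y), fun y _ _ => ?_⟩
    · rw [Finset.prod_empty, show (1 : Y.IdealSheafData) = ⊤ from rfl, Scheme.IdealSheafData.support_top]
      exact fun x hx => False.elim hx
    · rw [Finset.prod_empty, show (1 : Y.IdealSheafData) = ⊤ from rfl, Scheme.IdealSheafData.comap_top]
  | insert a S haS ih =>
    obtain ⟨ih1, ih2, ih3⟩ := ih (fun y hy => hT y (Finset.mem_insert_of_mem hy))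
      (fun y hy => hJ y (Finset.mem_insert_of_mem hy))
    have ha : IsClosed ({a} : Set Y) := hT a (Finset.mem_insert_self a S)
    have hJa : ((Jf a).support : Set Y) ⊆ {a} := hJ a (Finset.mem_insert_self a S)
    refine ⟨?_, fun y hy => ?_, fun y hyc hy => ?_⟩
    · rw [Finset.prod_insert haS, Scheme.IdealSheafData.support_mul, Closeds.coe_sup, Finset.coe_insert]
      exact Set.union_subset (hJa.trans (Set.singleton_subset_iff.mpr (Set.mem_insert a _)))
        (ih1.trans (Set.subset_insert a _))
    · rw [Finset.prod_insert haS, comap_mul]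
      rcases Finset.mem_insert.mp hy with rfl | hyS
      · rw [ih3 y ha haS]
        exact mul_one _
      · have hne : a ≠ y := fun h => haS (h ▸ hyS)
        rw [comap_fromSpecStalk_eq_top_of_support_subset ha hne (Jf a) hJa, ih2 y hyS]
        exact one_mul _
    · rw [Finset.prod_insert haS, comap_mul]
      have hne : a ≠ y := fun h => hy (h ▸ Finset.mem_insert_self a S)
      rw [comap_fromSpecStalk_eq_top_of_support_subset ha hne (Jf a) hJa,
        ih3 y hyc (fun h => hy (Finset.mem_insert_of_mem h))]
      exact mul_one _

/-! ## Step 3: the global desingularization -/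

/-- **Globalisation of local desingularizations by blowing ups** (integral Noetherian `Y`; `Z` a finite set of closed
points off the generic point, containing every non-regular point; for each `y ∈ Z` a desingularization of `Spec 𝒪_{Y,y}`
which is a blowing up along an ideal sheaf cosupported at the closed point): `Y` has a desingularization
(`IsResolution`: proper, birational, regular source) which is a blowing up along an ideal sheaf `J` with `V(J) ⊆ Z`.
Steps 1–3 of the module docstring. [this work] -/
theorem exists_isResolution_isBlowup_of_local [IsIntegral Y] [IsNoetherian Y]
    (Z : Set Y) (hZf : Z.Finite) (hZc : ∀ y ∈ Z, IsClosed ({y} : Set Y)) (hgen : genericPoint Y ∉ Z)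
    (hreg : ∀ y : Y, y ∉ Z → y ∈ Scheme.regularLocus Y)
    (hloc : ∀ y ∈ Z, ∃ (Xy : Scheme.{u}) (ρ : Xy ⟶ Spec (Y.presheaf.stalk y))
      (I : (Spec (Y.presheaf.stalk y)).IdealSheafData), IsResolution ρ ∧ IsBlowup ρ I ∧
        (I.support : Set (Spec (Y.presheaf.stalk y))) ⊆ {closedPoint (Y.presheaf.stalk y)}) :
    ∃ (X : Scheme.{u}) (f : X ⟶ Y) (J : Y.IdealSheafData),
      IsResolution f ∧ IsBlowup f J ∧ (J.support : Set Y) ⊆ Z := by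
  classical
  -- steps 1–2: the global ideal sheaf
  have key : ∀ y ∈ Z, ∃ (Jy : Y.IdealSheafData), ((Jy.support : Set Y) ⊆ {y}) ∧
      ∃ (Xy : Scheme.{u}) (ρ : Xy ⟶ Spec (Y.presheaf.stalk y)),
        IsResolution ρ ∧ IsBlowup ρ (Jy.comap (Y.fromSpecStalk y)) := by
    intro y hy
    obtain ⟨Xy, ρ, I, hρ, hρI, hI⟩ := hloc y hy
    obtain ⟨Jy, hJy, hsupp⟩ := exists_comap_fromSpecStalk_eq y (hZc y hy) I hI
    exact ⟨Jy, hsupp, Xy, ρ, hρ, by rw [hJy]; exact hρI⟩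
  choose! Jf hJsupp Xf ρf hρ hρJ using key
  let T : Finset Y := hZf.toFinset
  have hTZ : ∀ y, y ∈ T ↔ y ∈ Z := fun y => Set.Finite.mem_toFinset hZf
  obtain ⟨hJ1, hJ2, -⟩ := prod_support_subset_and_comap Jf T (fun y hy => hZc y ((hTZ y).mp hy))
    (fun y hy => hJsupp y ((hTZ y).mp hy))
  let J : Y.IdealSheafData := ∏ y ∈ T, Jf y
  have hJZ : (J.support : Set Y) ⊆ Z := fun x hx => (hTZ x).mp (Finset.mem_coe.mp (hJ1 hx))
  -- step 3: the blowing up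
  obtain ⟨X, f, hf⟩ := exists_isBlowup Y J
  have hJ0 : J ≠ ⊥ := by
    intro h
    apply hgen
    apply hJZ
    rw [h, Scheme.IdealSheafData.support_bot]
    trivial
  haveI : IsIntegral X := hf.isIntegral hJ0
  haveI : IsProper f := hf.isProper
  refine ⟨X, f, J, ⟨inferInstance, hf.isBirational' hJ0, fun x => ?_⟩, hf, hJZ⟩
  -- regularity of `X` at `x`
  by_cases hx : f x ∈ Z
  · -- over `y = f x ∈ Z`: base change to `Spec 𝒪_{Y,y}`
    set y := f x with hy_def
    haveI : Flat (Y.fromSpecStalk y) := flat_fromSpecStalk Y y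
    have hb : IsBlowup (pullback.snd f (Y.fromSpecStalk y)) ((Jf y).comap (Y.fromSpecStalk y)) := by
      rw [← hJ2 y ((hTZ y).mpr hx)]
      exact hf.pullback_snd_of_flat (Y.fromSpecStalk y)
    obtain ⟨e, -, -⟩ := hb.unique (hρJ y hx)
    have hregP : Scheme.IsRegular (pullback f (Y.fromSpecStalk y)) :=
      Scheme.IsRegular.of_iso e.inv (hρ y hx).isRegular
    obtain ⟨s, hs⟩ := mem_range_pullback_fst_fromSpecStalk_of_eq f y (x' := x) rfl
    have := (mem_regularLocus_iff_pullback_fst_fromSpecStalk f y s).mp (hregP s)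
    rw [hs] at this
    exact this
  · -- off `Z`: `f` is an isomorphism over `Y ∖ V(J) ∋ f x`
    haveI := hf.isIso_compl
    have hxU : f x ∈ (⟨(J.support : Set Y)ᶜ, J.support.isClosed.isOpen_compl⟩ : Y.Opens) :=
      fun h => hx (hJZ h)
    exact (mem_regularLocus_iff_of_isIso_morphismRestrict f _ x hxU).mpr (hreg (f x) hx)

end Summit.ResolutionOfSingularities.ResolutionOfSingularities.Theorems.NoZeno.GlobalResolution

end
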